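import Literature.NumberTheory.EllipticCurves.IwasawaNakayamaProofs
import Literature.NumberTheory.EllipticCurves.IwasawaAlgebraInvolution
import HarnessLib

/-!
# The `ι`-SEMILINEAR transpose of a `Λ`-adic pairing from a WEAK source (action clauses only) into an axiomatic Pontryagin dual
# (`IwasawaDual.IsDualPair`), and finite generation through a semilinear map into a Noetherian module — proofs only

Topic `NumberTheory/EllipticCurves` (grouping namespace `IwasawaDual`, as `IwasawaNakayamaProofs` / `IwasawaDualFunctorialityProofs`).
Width seat `cruxlead-stmt-BirchSwinnertonDyer-19573-w3` g10 (cell `pub/bsd-2adic`; consumer: `Kato2004/OrdinaryKernelFunctionalOfPoitouTateProofs.lean`,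
which transposes the `Λ`-adic local Tate pairing of `𝐇¹_{loc,Γ}(T_pW)` (Poitou–Tate fact p729889) into `X(E/ℚ_∞)` and reads off finite generation of
the ordinary quotient).  THEOREMS ONLY (no definition, no named fact, no instance, no notation, no `sorry`); nothing here is specific to any summit or
to elliptic curves: §1 is about abstract data `(X, S, ψ⁻, toDual)` / `(X′, S′, ψ′, toDual′)` over `Λ = ℤ_p⟦X⟧`, §2 about modules over rings.

## What is proved
* §1 `exists_involSemilinear_transpose_of_T_smul_of_C_smul` — for a `Λ`-module `X` with an ADDITIVE `toDual : X → Hom(S, ℚ/ℤ)` satisfying ONLY the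
  two action clauses (T) `toDual (X•x) s = toDual x (ψ⁻ s)` and (C) «constants act through `ℤ_p → ℤ/p^k` on `p^k`-torsion arguments» — NO
  bijectivity and NO local nilpotence on `S` (print: the `Λ`-adic local Tate pairing of `𝐇¹_{loc,Γ}(T)`, which is not perfect on its compact side as
  typed) —, a dual pair `(X′, S′, ψ′, toDual′)`, an endomorphism `ψ` of `S` with `(1 + ψ⁻)(1 + ψ) = 1 = (1 + ψ)(1 + ψ⁻)` (print: `ψ⁻ = γ⁻¹ − 1`,
  `ψ = γ − 1`) and an additive `φ : S′ → S` with `φ ∘ ψ′ = ψ ∘ φ`: there is `F : X →ₛₗ[ι] X′`, `ι : X ↦ (1+X)⁻¹ − 1` the Iwasawa involution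
  (`IwasawaAlgebra.involEquiv`), with `toDual′ (F x) s′ = toDual x (φ s′)`.  This is the LITERATURE-SIDE PORT of the Summits-side
  `SteinbergFibreAtTwo.exists_involSemilinear_transpose_of_adjoint` (w3 g3, `…ZetaColemanMuIotaAdjointTranspose.lean`; itself the weak-source form
  of w3 g2's `exists_involSemilinear_transpose`, p699159) — a Literature proof file cannot import `Summits`, and the consumer below is a
  Literature derivation; same `𝔪`-adic argument (Lang Ch. 5 §1; `IsDualPair.smul_mem_annPiece` on the target) with the source truncation
  `toDual_smul_eq_toDual_trunc_smul_of_T_smul` needing only `ψ⁻ⁿ(φ s′) = 0`, which follows from `ψ′ⁿ s′ = 0` because `ψ⁻ = −(1 + ψ⁻)ψ` commutes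
  with `ψ`.
* §2 `moduleFinite_quotient_ker_of_isNoetherian` — for `F : M →ₛₗ[σ] M₂` with `σ` SURJECTIVE (e.g. a ring automorphism) and `M₂` Noetherian,
  `M ⧸ ker F` is finitely generated (lift a finite generating set of `range F`).

References: [GreenbergLNM1716] §1 p. 60 (the Pontryagin dual as a `Λ`-module), §4 p. 122 («`G` and `G*` are orthogonal complements»);
[Lang1990] Ch. 5 §1; [MazurTateTeitelbaum1986Invent] Ch. I §17 (the involution); [Kato2004Asterisque] §17.13 (17.13.1) (p. 279).
Tree: `IwasawaNakayamaProofs.lean` (`IsDualPair`, pieces, annihilators), `IwasawaDualFunctorialityProofs.lean` (the `Λ`-LINEAR case, same key),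
`IwasawaAlgebraInvolution.lean` (`invol`, `invSubOne`), Summits p699159 and `…ZetaColemanMuIotaAdjointTranspose.lean` (w3 g3).
-/

set_option autoImplicit false

noncomputable section

open scoped Classical

namespace Literature.NumberTheory.EllipticCurves.IwasawaDual

/-! ## §1 The `ι`-semilinear transpose from a WEAK source (action clauses only) into a dual pair -/

section Transpose

variable {p : ℕ} [Fact p.Prime]
  {S : Type*} [AddCommGroup S] {ψm : AddMonoid.End S}
  {X : Type*} [AddCommGroup X] [Module (IwasawaAlgebra p) X] {toDual : X →+ (S →+ AddCircle (1 : ℚ))}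
  {S' : Type*} [AddCommGroup S'] {ψ' : AddMonoid.End S'}
  {X' : Type*} [AddCommGroup X'] [Module (IwasawaAlgebra p) X'] {toDual' : X' →+ (S' →+ AddCircle (1 : ℚ))}

/-- Iterated action clause (T): `toDual (Xʲ • x) s = toDual x (ψ⁻ʲ s)` (only (T) and additivity).
[cite: GreenbergLNM1716, §1 p. 60 (the Pontryagin dual as a Λ-module)] -/
theorem toDual_X_pow_smul_of_T_smul
    (hT : ∀ (x : X) (s : S), toDual ((PowerSeries.X : IwasawaAlgebra p) • x) s = toDual x (ψm s))
    (j : ℕ) (x : X) (s : S) :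
    toDual ((PowerSeries.X : IwasawaAlgebra p) ^ j • x) s = toDual x ((ψm ^ j) s) := by
  induction j generalizing s with
  | zero => simp
  | succ j ih =>
    rw [pow_succ', mul_smul, hT, ih, pow_succ, AddMonoid.End.coe_mul, Function.comp_apply]

/-- **A power series acts through its truncation on `ψ⁻`-nilpotent arguments** (only (T) and additivity): if `ψ⁻ⁿ s = 0` then
`toDual (f • x) s = toDual ((trunc_n f) • x) s` — the difference `(f − trunc_n f) • x = Xⁿ • (v • x)` pairs to `toDual (v • x) (ψ⁻ⁿ s) = 0`.
[cite: Lang1990, Ch. 5 §1] -/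
theorem toDual_smul_eq_toDual_trunc_smul_of_T_smul
    (hT : ∀ (x : X) (s : S), toDual ((PowerSeries.X : IwasawaAlgebra p) • x) s = toDual x (ψm s))
    (f : IwasawaAlgebra p) (x : X) {n : ℕ} {s : S} (hs : (ψm ^ n) s = 0) :
    toDual (f • x) s = toDual (((PowerSeries.trunc n f : Polynomial ℤ_[p]) : IwasawaAlgebra p) • x) s := by
  have hX : (PowerSeries.X : IwasawaAlgebra p) ^ n ∣ f - ((PowerSeries.trunc n f : Polynomial ℤ_[p]) : IwasawaAlgebra p) := by
    rw [PowerSeries.X_pow_dvd_iff]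
    intro m hm
    rw [map_sub, Polynomial.coeff_coe, PowerSeries.coeff_trunc, if_pos hm, sub_self]
  obtain ⟨v, hv⟩ := hX
  have h0 : toDual ((f - ((PowerSeries.trunc n f : Polynomial ℤ_[p]) : IwasawaAlgebra p)) • x) s = 0 := by
    rw [hv, mul_smul, toDual_X_pow_smul_of_T_smul hT, hs, map_zero]
  rwa [sub_smul, map_sub, AddMonoidHom.sub_apply, sub_eq_zero] at h0

omit [Fact p.Prime] in
/-- A homomorphism intertwining `ψ'` and `ψ` intertwines their powers. [folklore] -/
private theorem map_pow_apply_of_map_apply' {ψ : AddMonoid.End S} (φ : S' →+ S) (hφ : ∀ s', φ (ψ' s') = ψ (φ s'))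
    (j : ℕ) (s' : S') : φ ((ψ' ^ j) s') = (ψ ^ j) (φ s') := by
  induction j generalizing s' with
  | zero => simp
  | succ j ih =>
    rw [pow_succ, AddMonoid.End.coe_mul, Function.comp_apply, ih, hφ, pow_succ, AddMonoid.End.coe_mul,
      Function.comp_apply]

/-- **The `ι`-semilinear transpose from a weak source.**  Let `X` be a `Λ = ℤ_p⟦X⟧`-module with an ADDITIVE `toDual : X → Hom(S, ℚ/ℤ)`
satisfying only (T) `toDual (X•x) s = toDual x (ψ⁻ s)` and (C) «constants act through `ℤ_p → ℤ/p^k` on `p^k`-torsion values» (print: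
`X = 𝐇¹_{loc,Γ}(T_pW)`, `S = H¹(ℚ_∞, E[p^∞])`, the `Λ`-adic local Tate pairing, `ψ⁻ = conj_{γ⁻¹} − 1` — NOT a perfect pairing on this side), let
`(X′, S′, ψ′, toDual′)` be a dual pair (print: `X(E/ℚ_∞)`, `Sel_{p^∞}(E/ℚ_∞)`, `conj_γ − 1`), `ψ` an endomorphism of `S` with
`(1 + ψ⁻)(1 + ψ) = 1 = (1 + ψ)(1 + ψ⁻)` and `φ : S′ → S` additive with `φ ∘ ψ′ = ψ ∘ φ` (print: the inclusion `Sel ≤ H¹`).  Then the transpose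
`x ↦ toDual′⁻¹ (toDual x ∘ φ)` is `ι`-SEMILINEAR for the Iwasawa involution `ι : X ↦ (1+X)⁻¹ − 1`.  Proof: the `𝔪`-adic argument of
`IwasawaDual.IsDualPair.exists_linearMap_comp` / `SteinbergFibreAtTwo.exists_involSemilinear_transpose` — constants by (C) on both sides; `X` by the
recursion `toDual′ z s′ + toDual′ z (ψ′ s′) = −toDual x (ψ (φ s′))` for `z = ι(X)•F x` and induction on the `ψ′`-nilpotence of `s′`; polynomials;
power series through the pieces `S′_n`, the source truncation needing only `ψ⁻ⁿ(φ s′) = 0` (`toDual_smul_eq_toDual_trunc_smul_of_T_smul`), which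
follows from `ψ′ⁿ s′ = 0` because `ψ⁻ = −(1 + ψ⁻)ψ` commutes with `ψ`.  No bijectivity or local nilpotence is used on the source.
[cite: GreenbergLNM1716, §1 p. 60 and §4 p. 122] [cite: Lang1990, Ch. 5 §1] [cite: MazurTateTeitelbaum1986Invent, Ch. I §17] -/
theorem exists_involSemilinear_transpose_of_T_smul_of_C_smul
    (hT : ∀ (x : X) (s : S), toDual ((PowerSeries.X : IwasawaAlgebra p) • x) s = toDual x (ψm s))
    (hC : ∀ (c : ℤ_[p]) (x : X) (s : S) (k : ℕ), p ^ k • s = 0 →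
      toDual (PowerSeries.C c • x) s = (PadicInt.toZModPow k c).val • toDual x s)
    (h' : IsDualPair p ψ' toDual') (ψ : AddMonoid.End S) (hψ₁ : (1 + ψm) * (1 + ψ) = 1) (hψ₂ : (1 + ψ) * (1 + ψm) = 1)
    (φ : S' →+ S) (hφ : ∀ s', φ (ψ' s') = ψ (φ s')) :
    ∃ F : X →ₛₗ[((IwasawaAlgebra.involEquiv p).toRingEquiv : IwasawaAlgebra p →+* IwasawaAlgebra p)] X',
      ∀ (x : X) (s' : S'), toDual' (F x) s' = toDual x (φ s') := by
  -- the transpose as an additive map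
  let e' : X' ≃+ (S' →+ AddCircle (1 : ℚ)) := AddEquiv.ofBijective toDual' h'.bijective
  let F₀ : X →+ X' :=
    { toFun := fun x ↦ e'.symm ((toDual x).comp φ)
      map_zero' := by
        apply e'.injective
        rw [AddEquiv.apply_symm_apply, map_zero, map_zero, AddMonoidHom.zero_comp]
      map_add' := fun x y ↦ by
        apply e'.injective
        rw [AddEquiv.apply_symm_apply, map_add, map_add, AddEquiv.apply_symm_apply, AddEquiv.apply_symm_apply,
          AddMonoidHom.add_comp] }
  have hF₀ : ∀ (x : X) (s' : S'), toDual' (F₀ x) s' = toDual x (φ s') := fun x s' ↦ by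
    change e' (e'.symm ((toDual x).comp φ)) s' = _
    rw [AddEquiv.apply_symm_apply, AddMonoidHom.comp_apply]
  -- algebra of the two keys: `ψ⁻ = -ψ - ψ⁻ ψ` and `ψ⁻` commutes with `ψ`
  have hψm_eq : ψm = -((1 + ψm) * ψ) := by
    have h2 : (1 + ψm) * (1 + ψ) = (1 + ψm) + (1 + ψm) * ψ := by rw [mul_add, mul_one]
    rw [hψ₁] at h2
    have h3 : ψm + (1 + ψm) * ψ = 0 := by
      have h4 : (1 : AddMonoid.End S) + (ψm + (1 + ψm) * ψ) = 1 + 0 := by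
        rw [add_zero, ← add_assoc]
        exact h2.symm
      exact add_left_cancel h4
    exact eq_neg_of_add_eq_zero_left h3
  have hkey : ∀ t : S, ψm t = -(ψ t) - ψm (ψ t) := by
    intro t
    calc ψm t = (-((1 + ψm) * ψ)) t := by rw [← hψm_eq]
      _ = -(ψ t) - ψm (ψ t) := by
          show -(ψ t + ψm (ψ t)) = -(ψ t) - ψm (ψ t)
          rw [neg_add']
  have hcomm : Commute (1 + ψm) ψ := by
    have hc : Commute (1 + ψm) (1 + ψ) := by
      change (1 + ψm) * (1 + ψ) = (1 + ψ) * (1 + ψm)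
      rw [hψ₁, hψ₂]
    have hc2 := hc.sub_right (Commute.one_right (1 + ψm))
    rwa [add_sub_cancel_left] at hc2
  have hψm_pow_apply : ∀ (n : ℕ) (t : S), (ψ ^ n) t = 0 → (ψm ^ n) t = 0 := by
    intro n t ht
    have h5 : ψm ^ n = (-((1 + ψm) * ψ)) ^ n := by rw [← hψm_eq]
    rw [h5, neg_pow, hcomm.mul_pow, AddMonoid.End.coe_mul, Function.comp_apply, AddMonoid.End.coe_mul,
      Function.comp_apply, ht, map_zero, map_zero]
  -- constants act alike on both sides
  have hC' : ∀ (c : ℤ_[p]) (x : X), F₀ (PowerSeries.C c • x) = PowerSeries.C c • F₀ x := by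
    intro c x
    apply h'.bijective.1
    ext s'
    obtain ⟨k, hk⟩ := h'.locNil.torsion s'
    have hk' : p ^ k • φ s' = 0 := by rw [← map_nsmul, hk, map_zero]
    rw [hF₀, hC c x (φ s') k hk', h'.C_smul c (F₀ x) s' k hk, hF₀]
  -- `X` acts on the transpose through `ι(X) = (1+X)⁻¹ − 1`
  have hX1 : ∀ x : X, F₀ ((PowerSeries.X : IwasawaAlgebra p) • x) = IwasawaAlgebra.invSubOne p • F₀ x := by
    intro x
    set z : X' := IwasawaAlgebra.invSubOne p • F₀ x with hz
    have h1z : (1 + PowerSeries.X : IwasawaAlgebra p) • z = -((PowerSeries.X : IwasawaAlgebra p) • F₀ x) := by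
      rw [hz, ← mul_smul, ← neg_smul]
      congr 1
      have hm := IwasawaAlgebra.one_add_X_mul_one_add_invSubOne p
      rw [mul_add, mul_one] at hm
      linear_combination (exp := 1) hm
    have hrec : ∀ s', toDual' z s' = -(toDual x (ψ (φ s'))) - toDual' z (ψ' s') := by
      intro s'
      have hl : toDual' ((1 + PowerSeries.X : IwasawaAlgebra p) • z) s' = toDual' z s' + toDual' z (ψ' s') := by
        rw [add_smul, one_smul, map_add, AddMonoidHom.add_apply, h'.T_smul]
      have hr : toDual' (-((PowerSeries.X : IwasawaAlgebra p) • F₀ x)) s' = -(toDual x (ψ (φ s'))) := by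
        rw [map_neg, AddMonoidHom.neg_apply, h'.T_smul, hF₀, hφ]
      rw [h1z] at hl
      rw [hl] at hr
      exact eq_sub_of_add_eq hr
    have hind : ∀ (n : ℕ) (s' : S'), (ψ' ^ n) s' = 0 → toDual' z s' = toDual x (ψm (φ s')) := by
      intro n
      induction n with
      | zero =>
        intro s' hs'
        rw [pow_zero, AddMonoid.End.coe_one, id_eq] at hs'
        rw [hs', map_zero, map_zero, map_zero, map_zero]
      | succ n ih =>
        intro s' hs'
        have hs'' : (ψ' ^ n) (ψ' s') = 0 := by
          rwa [pow_succ, AddMonoid.End.coe_mul, Function.comp_apply] at hs'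
        rw [hrec s', ih (ψ' s') hs'', hφ, hkey (φ s'), map_sub, map_neg]
    apply h'.bijective.1
    ext s'
    obtain ⟨n, hn⟩ := h'.locNil.nil s'
    rw [hF₀, hT, ← hind n s' hn]
  -- powers of `X`
  have hXpow : ∀ (j : ℕ) (x : X), F₀ ((PowerSeries.X : IwasawaAlgebra p) ^ j • x) =
      IwasawaAlgebra.invSubOne p ^ j • F₀ x := by
    intro j
    induction j with
    | zero => intro x; rw [pow_zero, pow_zero, one_smul, one_smul]
    | succ j ih => intro x; rw [pow_succ', mul_smul, hX1, ih, ← mul_smul, ← pow_succ']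
  -- polynomials
  have hpoly : ∀ (q : Polynomial ℤ_[p]) (x : X),
      F₀ ((q : IwasawaAlgebra p) • x) = IwasawaAlgebra.invol p (q : IwasawaAlgebra p) • F₀ x := by
    intro q x
    induction q using Polynomial.induction_on' with
    | add q r hq hr => rw [Polynomial.coe_add, add_smul, map_add, map_add, add_smul, hq, hr]
    | monomial j c =>
      rw [← Polynomial.C_mul_X_pow_eq_monomial, Polynomial.coe_mul, Polynomial.coe_pow, Polynomial.coe_C,
        Polynomial.coe_X, mul_smul, hC', hXpow, map_mul, map_pow, IwasawaAlgebra.invol_C, IwasawaAlgebra.invol_X,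
        mul_smul]
  -- `ι` maps `(Xⁿ)` into `(Xⁿ)`: the tail acts into the annihilator of `S'_n`
  have htail : ∀ (n : ℕ) (f : IwasawaAlgebra p), ∀ j < n, (p : ℤ_[p]) ^ n ∣
      PowerSeries.coeff j (IwasawaAlgebra.invol p
        (f - ((PowerSeries.trunc n f : Polynomial ℤ_[p]) : IwasawaAlgebra p))) := by
    intro n f j hj
    have hXd : (PowerSeries.X : IwasawaAlgebra p) ^ n ∣
        f - ((PowerSeries.trunc n f : Polynomial ℤ_[p]) : IwasawaAlgebra p) := by
      rw [PowerSeries.X_pow_dvd_iff]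
      intro m hm
      rw [map_sub, Polynomial.coeff_coe, PowerSeries.coeff_trunc, if_pos hm, sub_self]
    obtain ⟨v, hv⟩ := hXd
    have hXι : (PowerSeries.X : IwasawaAlgebra p) ^ n ∣
        IwasawaAlgebra.invol p (f - ((PowerSeries.trunc n f : Polynomial ℤ_[p]) : IwasawaAlgebra p)) := by
      rw [hv, map_mul, map_pow, IwasawaAlgebra.invol_X]
      exact Dvd.dvd.mul_right (pow_dvd_pow_of_dvd
        (PowerSeries.X_dvd_iff.2 (IwasawaAlgebra.constantCoeff_invSubOne p)) n) _
    rw [PowerSeries.X_pow_dvd_iff] at hXι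
    rw [hXι j hj]
    exact dvd_zero _
  -- `ι`-semilinearity through the pieces of `S'`
  have hsmul : ∀ (f : IwasawaAlgebra p) (x : X), F₀ (f • x) = IwasawaAlgebra.invol p f • F₀ x := by
    intro f x
    rw [← sub_eq_zero]
    refine h'.eq_zero_of_forall_mem_annPiece fun n s' hs' ↦ ?_
    have hφs' : (ψm ^ n) (φ s') = 0 := by
      refine hψm_pow_apply n (φ s') ?_
      rw [← map_pow_apply_of_map_apply' φ hφ, (mem_piece.mp hs').2, map_zero]
    have hdecomp : IwasawaAlgebra.invol p f =
        IwasawaAlgebra.invol p ((PowerSeries.trunc n f : Polynomial ℤ_[p]) : IwasawaAlgebra p) +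
        IwasawaAlgebra.invol p (f - ((PowerSeries.trunc n f : Polynomial ℤ_[p]) : IwasawaAlgebra p)) := by
      rw [← map_add, add_sub_cancel]
    rw [map_sub, AddMonoidHom.sub_apply, sub_eq_zero, hF₀, toDual_smul_eq_toDual_trunc_smul_of_T_smul hT f x hφs',
      ← hF₀, hpoly, hdecomp, add_smul, map_add, AddMonoidHom.add_apply,
      h'.smul_mem_annPiece (htail n f) (F₀ x) s' hs', add_zero]
  refine ⟨{ toFun := F₀, map_add' := F₀.map_add, map_smul' := fun r x ↦ ?_ }, hF₀⟩
  change F₀ (r • x) = IwasawaAlgebra.invol p r • F₀ x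
  exact hsmul r x

end Transpose

/-! ## §2 Finite generation through a semilinear map into a Noetherian module -/

section FiniteGeneration

/-- **A module with a semilinear map into a Noetherian module has finitely generated `M ⧸ ker F`** (semilinear along a SURJECTIVE ring
homomorphism, e.g. a ring automorphism): `range F` is a finitely generated submodule of `M₂`; lift a finite generating set; every `x` is
congruent modulo `ker F` to an element of the span of the lifts (surjectivity of `σ` adjusts the coefficients).
[cite: AtiyahMacdonald1969, Ch. 6, Prop. 6.2–6.3 (submodules and quotients of Noetherian modules)] -/
theorem moduleFinite_quotient_ker_of_isNoetherian {R R₂ M M₂ : Type*} [Ring R] [Ring R₂]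
    [AddCommGroup M] [Module R M] [AddCommGroup M₂] [Module R₂ M₂]
    {σ : R →+* R₂} [RingHomSurjective σ] [IsNoetherian R₂ M₂] (F : M →ₛₗ[σ] M₂) :
    Module.Finite R (M ⧸ LinearMap.ker F) := by
  have hfg : (Submodule.span R₂ (Set.range F)).FG := IsNoetherian.noetherian _
  obtain ⟨T, hT, hspan⟩ := (Submodule.fg_span_iff_fg_span_finset_subset (Set.range F)).mp hfg
  have hpre : ∀ t : T, ∃ x : M, F x = (t : M₂) := fun t ↦ hT t.2
  choose g hg using hpre
  set M₀ : Submodule R M := Submodule.span R (Set.range g) with hM₀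
  have hM₀fg : M₀.FG := Submodule.fg_span (Set.finite_range g)
  have hle : LinearMap.range F ≤ M₀.map F := by
    intro y hy
    have hy' : y ∈ Submodule.span R₂ (Set.range F) := by
      rw [← LinearMap.coe_range, Submodule.span_eq]
      exact hy
    rw [hspan] at hy'
    refine (Submodule.span_le.mpr ?_) hy'
    intro t ht
    exact ⟨g ⟨t, ht⟩, Submodule.subset_span ⟨⟨t, ht⟩, rfl⟩, hg ⟨t, ht⟩⟩
  have htop : M₀.map (LinearMap.ker F).mkQ = ⊤ := by
    rw [eq_top_iff]
    rintro q -
    obtain ⟨x, rfl⟩ := Submodule.mkQ_surjective _ q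
    obtain ⟨m, hm, hmx⟩ := hle (LinearMap.mem_range_self F x)
    refine ⟨m, hm, ?_⟩
    rw [Submodule.mkQ_apply, Submodule.mkQ_apply, Submodule.Quotient.eq, LinearMap.mem_ker, map_sub, hmx, sub_self]
  rw [Module.finite_def, ← htop]
  exact hM₀fg.map _

end FiniteGeneration

end Literature.NumberTheory.EllipticCurves.IwasawaDual

end
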